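import Literature.Computability.AlgebraicComplexity.GlobalStageParameters
import HarnessLib

/-!
# The exponent of the one-region global stage: `log₂ #copies ≥ n · E₁ − (explicit lower-order terms)`
(Vassilevska Williams–Xu–Xu–Zhou 2024, Prop. 5.1 / §5.7: "the number of copies we obtained (in the
first region) is `2^{A₁ n · min{H(α_X) − P_α, H(α_Y) − P_α, H(γ̄_Z) − λ_Z} − o(n)}`") — proved

Topic `Literature/Computability/AlgebraicComplexity`.  This file turns the exact one-region count of
`GlobalStageParameters.lean` (`⌊|B| |𝒯α| / (2M²r)⌋` copies, `M₀ < M ≤ 2M₀`,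
`|B| ≥ (M/2)e^{-4√log M}`) into the printed exponent, at FIXED `n` and with every lower-order term
explicit (no `o(n)`): with `Q` the joint type of `𝒯α` (so `numalpha = binom(n; Q)`), `μ_X, μ_Y` the
marginal types, `θ` the joint type of the typical pairs `(K, K̂)` and `k_S` the integral class types
of Def. 5.15 (so `C = ∏_S binom(|S|; k_S)`),

* `logb_copies_ge` — `log₂ (⌊|B|A/(2M²r)⌋ + 1) ≥ log₂ A − log₂ M₀ − log₂ r − 4√(log 2M₀)/log 2 − 3`;
* `modulusBound_le` — `M₀ ≤ max{16|𝒯|/|X-blocks|, 16|𝒯|/|Y-blocks|, 160 N V, 2c+2}` (reals);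
* the entropy estimates of the counts (Lemma 3.3 = `abs_logb_multinomial_sub_le` and Le Gall's type
  count `card_typedSupport_le_two_rpow_maxEntropy`): `log₂ A ≥ n H(Q/n) − |S₃| log₂(n+1)`,
  `log₂ |𝒯| ≤ |S₃| log₂(n+1) + n · maxEnt`, `log₂ |X-blocks| ≥ n H(μ_X/n) − (2c+1) log₂(n+1)`,
  `log₂ V ≤ log₂ A + Λ − n H(θ/n) + |A_pair| log₂(n+1)` (`Λ = ∑_S |S| H(k_S/|S|) = n λ_Z`, via the
  double count `V · binom(n; θ) = A · C` of Claim 5.14);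
* `vxxz2024_prop51_region_logb` — **the assembled bound**:
  `log₂(#copies + 1) ≥ n · min{H(μ_X/n) − P, H(μ_Y/n) − P, H(θ/n) − Λ/n, H(Q/n)} − Err`, where
  `P = maxEnt_{levelSupport}(Q/n) − H(Q/n)` is the penalty `P_α` at the type `Q/n`, and
  `Err = (2|S₃| + 2c + 1 + |A_pair|) log₂(n+1) + log₂(160N) + log₂(2c+2) + log₂ r + 4√(log 2M₀)/log 2 + 7`
  (the fourth term `H(Q/n) ≥ H(μ_X/n) − P` is dominated; it records the branch `M₀ = 2c+2`).

Everything is proved; no definitions; no named facts.  Letting `n → ∞` along types `Q/n → α`,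
`k_S/|S| → γ` (continuity of `H`; the `ε`-interface tensors of Thm. 5.3) is not part of this file.

## References

* V. Vassilevska Williams, Y. Xu, Z. Xu, R. Zhou, *New bounds for matrix multiplication: from alpha
  to omega*, SODA 2024, arXiv:2307.07970 (held: `paper:arxiv-2307.07970`), Prop. 5.1, Claim 5.4,
  Claim 5.14, §5.7 (Summary). [VassilevskaWilliamsXuXuZhou2024]
-/

noncomputable section

open scoped BigOperators
open Finset

namespace Literature.Computability.AlgebraicComplexity

open Literature.Barriers.MatrixMultiplication (bigCwTensor)

/-! ## Arithmetic: the copy count and the modulus bound in logarithmic form -/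

section Arithmetic

/-- **The copy count in logarithmic form**: with `M₀ < M ≤ 2M₀`, `|B| ≥ (M/2) e^{-4√(log M)}`, `r ≥ 1`,
the number `⌊|B| A / (2M²r)⌋` of copies satisfies
`log₂ (⌊|B|A/(2M²r)⌋ + 1) ≥ log₂ A − log₂ M₀ − log₂ r − 4 √(log (2M₀)) / log 2 − 3`. [cite: VassilevskaWilliamsXuXuZhou2024, §5.6 ("numalpha · M^{-1-o(1)} copies")] -/
theorem logb_copies_ge {A M M₀ r Bc : ℕ} (hM₀ : 0 < M₀) (hM₀M : M₀ < M) (hM2 : M ≤ 2 * M₀) (hr : 0 < r)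
    (hB : (M : ℝ) / 2 * Real.exp (-4 * Real.sqrt (Real.log M)) ≤ Bc) (hA : 0 < A) :
    Real.logb 2 A - Real.logb 2 M₀ - Real.logb 2 r - 4 * Real.sqrt (Real.log (2 * M₀)) / Real.log 2 - 3 ≤
      Real.logb 2 ((Bc * A / (2 * M ^ 2 * r) : ℕ) + 1 : ℝ) := by
  have hMnat : 0 < M := hM₀.trans hM₀M
  have hMpos : (0 : ℝ) < M := by exact_mod_cast hMnat
  have hM₀pos : (0 : ℝ) < M₀ := by exact_mod_cast hM₀
  have hrpos : (0 : ℝ) < r := by exact_mod_cast hr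
  have hApos : (0 : ℝ) < A := by exact_mod_cast hA
  have hlog2 : 0 < Real.log 2 := Real.log_pos one_lt_two
  have hdnat : 0 < 2 * M ^ 2 * r := by positivity
  have hfloor : ((Bc * A : ℕ) : ℝ) / ((2 * M ^ 2 * r : ℕ) : ℝ) ≤ ((Bc * A / (2 * M ^ 2 * r) : ℕ) : ℝ) + 1 := by
    have hd : (0 : ℝ) < ((2 * M ^ 2 * r : ℕ) : ℝ) := by exact_mod_cast hdnat
    rw [div_le_iff₀ hd]
    have h' : Bc * A < (Bc * A / (2 * M ^ 2 * r) + 1) * (2 * M ^ 2 * r) := by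
      rw [Nat.add_mul, one_mul]; exact Nat.lt_div_mul_add hdnat
    have h'' : ((Bc * A : ℕ) : ℝ) < ((Bc * A / (2 * M ^ 2 * r) + 1 : ℕ) : ℝ) * ((2 * M ^ 2 * r : ℕ) : ℝ) := by
      exact_mod_cast h'
    push_cast at h'' ⊢
    linarith
  have hE : Real.exp (-4 * Real.sqrt (Real.log (2 * M₀))) ≤ Real.exp (-4 * Real.sqrt (Real.log M)) := by
    rw [Real.exp_le_exp]
    have : Real.log M ≤ Real.log (2 * M₀) := Real.log_le_log hMpos (by exact_mod_cast hM2)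
    have := Real.sqrt_le_sqrt this
    linarith
  have hq : (A : ℝ) * Real.exp (-4 * Real.sqrt (Real.log (2 * M₀))) / (8 * M₀ * r) ≤
      ((Bc * A : ℕ) : ℝ) / ((2 * M ^ 2 * r : ℕ) : ℝ) := by
    push_cast
    have hBc : (M : ℝ) / 2 * Real.exp (-4 * Real.sqrt (Real.log (2 * M₀))) ≤ Bc :=
      le_trans (mul_le_mul_of_nonneg_left hE (by positivity)) hB
    rw [div_le_div_iff₀ (by positivity) (by positivity)]
    have h1 : (A : ℝ) * Real.exp (-4 * Real.sqrt (Real.log (2 * M₀))) * (2 * (M : ℝ) ^ 2 * r) =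
        ((M : ℝ) / 2 * Real.exp (-4 * Real.sqrt (Real.log (2 * M₀)))) * A * (4 * M * r) := by ring
    rw [h1]
    have h2 : ((M : ℝ) / 2 * Real.exp (-4 * Real.sqrt (Real.log (2 * M₀)))) * A * (4 * M * r) ≤
        (Bc : ℝ) * A * (4 * M * r) := by
      have : 0 ≤ (A : ℝ) * (4 * M * r) := by positivity
      nlinarith
    refine h2.trans ?_
    have hM2' : (M : ℝ) ≤ 2 * M₀ := by exact_mod_cast hM2
    have : (0 : ℝ) ≤ (Bc : ℝ) * A * r := by positivity
    nlinarith
  have hpos : 0 < (A : ℝ) * Real.exp (-4 * Real.sqrt (Real.log (2 * M₀))) / (8 * M₀ * r) := by positivity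
  have hle := hq.trans hfloor
  have hlog := Real.logb_le_logb_of_le (b := 2) one_lt_two hpos hle
  refine le_trans ?_ hlog
  rw [Real.logb_div (by positivity) (by positivity), Real.logb_mul (by positivity) (by positivity),
    Real.logb_mul (by positivity) (by positivity), Real.logb_mul (by positivity) (by positivity)]
  have hexp : Real.logb 2 (Real.exp (-4 * Real.sqrt (Real.log (2 * M₀)))) = -4 * Real.sqrt (Real.log (2 * M₀)) / Real.log 2 := by
    rw [Real.logb, Real.log_exp]
  have h8 : Real.logb 2 (8 : ℝ) = 3 := by
    rw [show (8 : ℝ) = 2 ^ (3 : ℕ) by norm_num, Real.logb_pow, Real.logb_self_eq_one one_lt_two]; norm_num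
  rw [hexp, h8]
  ring_nf
  rfl

/-- `⌊8T/X⌋ + 1 ≤ max(16 T/X, 2)` (reals), `X ≥ 1`. [folklore] -/
theorem natDiv_succ_le_max (T X : ℕ) (hX : 0 < X) :
    ((8 * T / X + 1 : ℕ) : ℝ) ≤ max (16 * (T : ℝ) / X) 2 := by
  have hXr : (0 : ℝ) < X := by exact_mod_cast hX
  have hdiv : ((8 * T / X : ℕ) : ℝ) ≤ 8 * (T : ℝ) / X := by
    rw [le_div_iff₀ hXr]; exact_mod_cast Nat.div_mul_le_self (8 * T) X
  push_cast
  by_cases h1 : (1 : ℝ) ≤ 8 * (T : ℝ) / X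
  · refine le_trans ?_ (le_max_left _ _)
    have : 16 * (T : ℝ) / X = 2 * (8 * (T : ℝ) / X) := by ring
    rw [this]; linarith
  · refine le_trans ?_ (le_max_right _ _)
    rw [not_le] at h1
    linarith

end Arithmetic

/-- The bookkeeping behind the exponent: abstract real form (four branches of `M₀`). [folklore] -/
theorem exponent_combine {n HQ mE HX HY Hθ Λ ℓ s₃ sp cX lA lT lX lY lV lM₀ l160 l2c : ℝ}
    (hn : 0 < n) (hℓ : 0 ≤ ℓ) (hs₃ : 0 ≤ s₃) (hsp : 0 ≤ sp) (hcX : 0 ≤ cX) (h160 : 0 ≤ l160) (h2c : 0 ≤ l2c)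
    (eA : n * HQ - s₃ * ℓ ≤ lA) (eT : lT ≤ s₃ * ℓ + n * mE) (eX : n * HX - cX * ℓ ≤ lX) (eY : n * HY - cX * ℓ ≤ lY)
    (hM₀ : lM₀ ≤ 4 + lT - lX ∨ lM₀ ≤ 4 + lT - lY ∨ (lM₀ ≤ l160 + lV ∧ lV ≤ lA + Λ - n * Hθ + sp * ℓ) ∨ lM₀ ≤ l2c) :
    n * min (min (HX - (mE - HQ)) (HY - (mE - HQ))) (min (Hθ - Λ / n) HQ) -
        ((2 * s₃ + cX + sp) * ℓ + l160 + l2c + 4) ≤ lA - lM₀ := by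
  set m := min (min (HX - (mE - HQ)) (HY - (mE - HQ))) (min (Hθ - Λ / n) HQ) with hm
  have hmin1 : m ≤ HX - (mE - HQ) := (min_le_left _ _).trans (min_le_left _ _)
  have hmin2 : m ≤ HY - (mE - HQ) := (min_le_left _ _).trans (min_le_right _ _)
  have hmin3 : m ≤ Hθ - Λ / n := (min_le_right _ _).trans (min_le_left _ _)
  have hmin4 : m ≤ HQ := (min_le_right _ _).trans (min_le_right _ _)
  have p1 := mul_le_mul_of_nonneg_left hmin1 hn.le
  have p2 := mul_le_mul_of_nonneg_left hmin2 hn.le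
  have p3 := mul_le_mul_of_nonneg_left hmin3 hn.le
  have p4 := mul_le_mul_of_nonneg_left hmin4 hn.le
  have e3 : n * (Hθ - Λ / n) = n * Hθ - Λ := by field_simp
  rw [e3] at p3
  have hsl : 0 ≤ s₃ * ℓ := mul_nonneg hs₃ hℓ
  have hspl : 0 ≤ sp * ℓ := mul_nonneg hsp hℓ
  have hcl : 0 ≤ cX * ℓ := mul_nonneg hcX hℓ
  rcases hM₀ with h1 | h2 | ⟨h3, hV⟩ | h4
  · nlinarith [p1, h1, eA, eT, eX, hsl, hspl, hcl]
  · nlinarith [p2, h2, eA, eT, eY, hsl, hspl, hcl]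
  · nlinarith [p3, h3, hV, eA, hsl, hspl, hcl]
  · nlinarith [p4, h4, eA, hsl, hspl, hcl]

/-! ## The bound `M₀` and the counts in entropy form -/

namespace GlobalStageData

open scoped Classical

universe u

variable {c n M : ℕ} {D : GlobalStageData c n M}

/-- **`M₀ ≤ max{16|𝒯|/|typeClass μX|, 16|𝒯|/|typeClass μY|, 160 N V, 2c+2}`** (reals), when the type
classes are non-empty. [cite: VassilevskaWilliamsXuXuZhou2024, §5.6 (M₀)] -/
theorem modulusBound_le (p₀ : (Fin n → Fin (2 * c + 1)) × (Fin n → Fin c → Fin 3))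
    (hX : 0 < (typeClass n D.μX).card) (hY : 0 < (typeClass n D.μY).card) :
    (D.modulusBound p₀ : ℝ) ≤
      max (max (16 * (D.tripleSet.card : ℝ) / (typeClass n D.μX).card) (16 * (D.tripleSet.card : ℝ) / (typeClass n D.μY).card))
        (max (160 * (c * n) * ((D.compatTriples p₀.1 p₀.2).card : ℝ)) (2 * c + 2)) := by
  unfold modulusBound
  push_cast [Nat.cast_max]
  have h1 := natDiv_succ_le_max D.tripleSet.card _ hX
  have h2 := natDiv_succ_le_max D.tripleSet.card _ hY
  push_cast at h1 h2
  have h22 : (2 : ℝ) ≤ 2 * c + 2 := by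
    have : (0 : ℝ) ≤ c := Nat.cast_nonneg c
    linarith
  refine max_le (max_le ?_ ?_) (max_le ?_ ?_)
  · rcases le_max_iff.1 h1 with h | h
    · exact le_trans h (le_max_of_le_left (le_max_left _ _))
    · exact le_trans h (le_max_of_le_right (le_trans h22 (le_max_right _ _)))
  · rcases le_max_iff.1 h2 with h | h
    · exact le_trans h (le_max_of_le_left (le_max_right _ _))
    · exact le_trans h (le_max_of_le_right (le_trans h22 (le_max_right _ _)))
  · exact le_max_of_le_right (le_max_left _ _)
  · exact le_max_of_le_right (le_max_right _ _)

/-- **`log₂ numalpha ≥ n H(Q/n) − |S₃| log₂(n+1)`** for `𝒯α` the triples of joint type `Q`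
(Claim 5.4 / Lemma 3.3). [cite: VassilevskaWilliamsXuXuZhou2024, Claim 5.4 and Lemma 3.3] -/
theorem logb_card_alphaTriples_ge {Q : Fin (2 * c + 1) × Fin (2 * c + 1) × Fin (2 * c + 1) → ℕ}
    (h : D.𝒯α = jointTypeClass n Q) (hQ : ∑ s, Q s = n) :
    (n : ℝ) * shannonEntropy (fun s => (Q s : ℝ) / n) -
        Fintype.card (Fin (2 * c + 1) × Fin (2 * c + 1) × Fin (2 * c + 1)) * Real.logb 2 ((n : ℝ) + 1) ≤
      Real.logb 2 (D.𝒯α.card) := by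
  rw [card_alphaTriples_eq_multinomial h hQ]
  have := abs_logb_multinomial_sub_le Q hQ
  rw [abs_le] at this
  linarith [this.1]

/-- **`log₂ numalpha ≤ n H(Q/n)`.** [cite: VassilevskaWilliamsXuXuZhou2024, Claim 5.4 and Lemma 3.3] -/
theorem logb_card_alphaTriples_le {Q : Fin (2 * c + 1) × Fin (2 * c + 1) × Fin (2 * c + 1) → ℕ}
    (h : D.𝒯α = jointTypeClass n Q) (hQ : ∑ s, Q s = n) :
    Real.logb 2 (D.𝒯α.card) ≤ (n : ℝ) * shannonEntropy (fun s => (Q s : ℝ) / n) := by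
  rw [card_alphaTriples_eq_multinomial h hQ]
  have hm : (0 : ℝ) < Nat.multinomial univ Q := by exact_mod_cast Nat.multinomial_pos _ _
  have := Real.logb_le_logb_of_le (b := 2) one_lt_two hm (multinomial_le_two_rpow_mul_shannonEntropy Q hQ)
  rwa [Real.logb_rpow two_pos (by norm_num)] at this

/-- **`log₂ |𝒯| ≤ |S₃| log₂(n+1) + n · maxEnt`** — Le Gall's type count at the marginals of `Q/n`
(the penalty term `P_α` enters through `maxEnt − H`). [cite: VassilevskaWilliamsXuXuZhou2024, §5 (preamble: P_α) and Claim 5.4] -/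
theorem logb_card_tripleSet_le (hn : 0 < n) {Q : Fin (2 * c + 1) × Fin (2 * c + 1) × Fin (2 * c + 1) → ℕ}
    (hμX : D.μX = fun i => ∑ j, ∑ l, Q (i, j, l)) (hμY : D.μY = fun j => ∑ i, ∑ l, Q (i, j, l))
    (hμZ : D.μZ = fun l => ∑ i, ∑ j, Q (i, j, l)) :
    Real.logb 2 (D.tripleSet.card) ≤
      Fintype.card (Fin (2 * c + 1) × Fin (2 * c + 1) × Fin (2 * c + 1)) * Real.logb 2 ((n : ℝ) + 1) +
        (n : ℝ) * maxEntropyGivenMarginals (levelSupport (2 * c)) (fun s => (Q s : ℝ) / n) := by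
  have hcard := card_typedSupport_le_two_rpow_maxEntropy (levelSupport (2 * c)) hn Q (fun s => (Q s : ℝ) / n)
    (fun _ => rfl)
  have hT : D.tripleSet = typedSupport (levelSupport (2 * c)) n (fun i => ∑ j, ∑ l, Q (i, j, l))
      (fun j => ∑ i, ∑ l, Q (i, j, l)) (fun l => ∑ i, ∑ j, Q (i, j, l)) := by
    rw [tripleSet, hμX, hμY, hμZ]
  rw [hT]
  rcases Nat.eq_zero_or_pos (typedSupport (levelSupport (2 * c)) n (fun i => ∑ j, ∑ l, Q (i, j, l))
      (fun j => ∑ i, ∑ l, Q (i, j, l)) (fun l => ∑ i, ∑ j, Q (i, j, l))).card with h0 | hpos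
  · rw [h0]
    simp only [Nat.cast_zero, Real.logb_zero]
    have h1 : (0 : ℝ) ≤ Real.logb 2 ((n : ℝ) + 1) :=
      Real.logb_nonneg one_lt_two (by have := Nat.cast_nonneg (α := ℝ) n; linarith)
    have h2 : (0 : ℝ) ≤ maxEntropyGivenMarginals (levelSupport (2 * c)) (fun s => (Q s : ℝ) / n) := by
      unfold maxEntropyGivenMarginals
      refine Real.sSup_nonneg ?_
      rintro x ⟨P, hP, rfl⟩
      exact shannonEntropy_nonneg_of_mem_stdSimplex hP.1
    positivity
  · have hlog := Real.logb_le_logb_of_le (b := 2) one_lt_two (by exact_mod_cast hpos) hcard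
    refine hlog.trans (le_of_eq ?_)
    have hn1 : (0 : ℝ) < (n : ℝ) + 1 := by positivity
    rw [Real.logb_mul (pow_pos hn1 _).ne' (Real.rpow_pos_of_pos two_pos _).ne', Real.logb_pow,
      Real.logb_rpow two_pos (by norm_num)]

/-- **`log₂ |typeClass n μ| ≥ n H(μ/n) − |A| log₂(n+1)`** (Lemma 3.3, lower half). [cite: VassilevskaWilliamsXuXuZhou2024, Lemma 3.3] -/
theorem logb_card_typeClass_ge {A' : Type*} [Fintype A'] [DecidableEq A'] (μ : A' → ℕ) (hμ : ∑ a, μ a = n) :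
    (n : ℝ) * shannonEntropy (fun a => (μ a : ℝ) / n) - Fintype.card A' * Real.logb 2 ((n : ℝ) + 1) ≤
      Real.logb 2 ((typeClass n μ).card) := by
  have h := two_rpow_entropy_le_card_typeClass μ hμ (fun a => (μ a : ℝ) / n) (fun _ => rfl)
  have hpos : 0 < (typeClass n μ).card := card_pos.2 (typeClass_nonempty n μ hμ)
  have hn1 : (0 : ℝ) < (n : ℝ) + 1 := by positivity
  have hlog := Real.logb_le_logb_of_le (b := 2) one_lt_two (Real.rpow_pos_of_pos two_pos _) h
  rw [Real.logb_rpow two_pos (by norm_num), Real.logb_mul (pow_pos hn1 _).ne' (by exact_mod_cast hpos.ne'),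
    Real.logb_pow] at hlog
  linarith

/-- **`log₂ V ≤ log₂ numalpha + Λ − n H(θ/n) + |A_pair| log₂(n+1)`** for `V ≥ 1`: the double count
`V · binom(n; θ) = numalpha · C` (Claim 5.14), `C ≤ 2^Λ` (the product form, `Λ = ∑_S |S| H(k_S/|S|)`)
and `binom(n; θ) ≥ 2^{n H(θ/n)} / (n+1)^{|A_pair|}`. [cite: VassilevskaWilliamsXuXuZhou2024, Claim 5.14] -/
theorem logb_card_compatTriples_le (hD : D.WellFormed) (hS : D.Symmetric)
    {T₀ : (Fin n → Fin (2 * c + 1)) × (Fin n → Fin (2 * c + 1)) × (Fin n → Fin (2 * c + 1))} (hT₀ : T₀ ∈ D.𝒯α)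
    {p₀ : (Fin n → Fin (2 * c + 1)) × (Fin n → Fin c → Fin 3)} (hp₀ : p₀ ∈ D.typicalPairs)
    (kc : Fin (coarseClasses c).card → (Fin c → Fin 3) → ℕ)
    (hk : ∀ s σ, (kc s σ : ℝ) = (termFibre (coarseTermMap (isLevelTriple_of_mem_tripleSet (hD.subset hT₀))) s).card *
      (coarseTermList c D.α D.γZ s).γX σ)
    (hsupp : ∀ s σ, kc s σ ≠ 0 → patternLevel σ = (coarseTermList c D.α D.γZ s).i)
    (hsum : ∀ s, ∑ σ, kc s σ = (termFibre (coarseTermMap (isLevelTriple_of_mem_tripleSet (hD.subset hT₀))) s).card)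
    (hV : 0 < (D.compatTriples p₀.1 p₀.2).card) :
    Real.logb 2 ((D.compatTriples p₀.1 p₀.2).card) ≤
      Real.logb 2 (D.𝒯α.card) +
        (∑ s, ((termFibre (coarseTermMap (isLevelTriple_of_mem_tripleSet (hD.subset hT₀))) s).card : ℝ) *
          shannonEntropy (fun σ => (kc s σ : ℝ) / (termFibre (coarseTermMap (isLevelTriple_of_mem_tripleSet (hD.subset hT₀))) s).card)) -
        (n : ℝ) * shannonEntropy (fun a => (letterCount (pairSeq p₀.1 p₀.2) a : ℝ) / n) +
        Fintype.card (Fin (2 * c + 1) × (Fin c → Fin 3)) * Real.logb 2 ((n : ℝ) + 1) := by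
  have hμ : ∀ T ∈ D.𝒯α, letterCount T.2.2 = D.μZ := fun T hT => (mem_typedSupport.1 (hD.subset hT)).2.2.1
  have hcount := vxxz2024_claim514_count hS hμ hT₀ hp₀
  set V := (D.compatTriples p₀.1 p₀.2).card with hVdef
  set θ := letterCount (pairSeq p₀.1 p₀.2) with hθ
  have hθsum : ∑ a, θ a = n := sum_letterCount _
  rw [card_typeClass_eq_multinomial n θ hθsum] at hcount
  -- reals
  have hP : (0 : ℝ) < Nat.multinomial univ θ := by exact_mod_cast Nat.multinomial_pos _ _
  have hA : (0 : ℝ) < D.𝒯α.card := by exact_mod_cast card_pos.2 ⟨T₀, hT₀⟩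
  have hVr : (0 : ℝ) < V := by exact_mod_cast hV
  have hC : (0 : ℝ) < D.compatCount T₀ := by
    have : (V : ℝ) * Nat.multinomial univ θ = D.𝒯α.card * D.compatCount T₀ := by exact_mod_cast hcount
    by_contra hle
    rw [not_lt] at hle
    have hC0 : (D.compatCount T₀ : ℝ) = 0 := le_antisymm hle (Nat.cast_nonneg _)
    rw [hC0, mul_zero] at this
    exact (mul_pos hVr hP).ne' this
  have hreal : (V : ℝ) = D.𝒯α.card * D.compatCount T₀ / Nat.multinomial univ θ := by
    rw [eq_div_iff hP.ne']; exact_mod_cast hcount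
  have hCle := compatCount_le_two_rpow hD hT₀ kc hk hsupp hsum
  have hPge := two_rpow_mul_shannonEntropy_le_mul_multinomial θ hθsum
  have hn1 : (0 : ℝ) < (n : ℝ) + 1 := by positivity
  rw [hreal, Real.logb_div (by positivity) hP.ne', Real.logb_mul hA.ne' hC.ne']
  have h1 := Real.logb_le_logb_of_le (b := 2) one_lt_two hC hCle
  rw [Real.logb_rpow two_pos (by norm_num)] at h1
  have h2 := Real.logb_le_logb_of_le (b := 2) one_lt_two (Real.rpow_pos_of_pos two_pos _) hPge
  rw [Real.logb_rpow two_pos (by norm_num), Real.logb_mul (pow_pos hn1 _).ne' hP.ne', Real.logb_pow] at h2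
  linarith

/-- **VXXZ Prop. 5.1, one region: the exponent, with explicit lower-order terms.**  Data: well-formed
symmetric `D` (`c, n ≥ 1`) whose `𝒯α` is the set of triples of joint type `Q` (`∑ Q = n`, marginal
types `μ_X, μ_Y, μ_Z` of `Q`), a triple `T₀ ∈ 𝒯α`, a typical pair `p₀ = (K, K̂)` with joint type `θ`, and
integral class types `k_S` of the Def. 5.15 classes of `T₀` (`Λ = ∑_S |S| H(k_S/|S|) = n λ_Z`).  With
the parameters of `vxxz2024_prop51_region_parameters` (`M₀ < M ≤ 2M₀`, `B` Behrend) and any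
`r ≥ 8^{3⌊log_{2N} 3^N⌋+3}`, the power `(CW_q^{⊗c})^{⊗n}` restricts to `⟨κ⟩ ⊗ 𝒯*_{T₀}`,
`κ = ⌊|B||𝒯α|/(2M²r)⌋`, and
`log₂(κ+1) ≥ n · min{H(μ_X/n) − P, H(μ_Y/n) − P, H(θ/n) − Λ/n, H(Q/n)} − Err`,
`P = maxEnt_{levelSupport}(Q/n) − H(Q/n)`,
`Err = (2|S₃| + (2c+1) + |A_pair|) log₂(n+1) + log₂(160cn) + log₂(2c+2) + log₂ r + 4√(log 2M₀)/log 2 + 7`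
— the printed `2^{A₁n · min{H(α_X) − P_α, H(α_Y) − P_α, H(γ̄_Z) − λ_Z} − o(n)}` at the type `Q/n`.
[cite: VassilevskaWilliamsXuXuZhou2024, Prop. 5.1 and §5.7 (Summary)] -/
theorem vxxz2024_prop51_region_logb {M₁ : ℕ} (D : GlobalStageData c n M₁) (hD : D.WellFormed)
    (hS : D.Symmetric) (R : Type u) [CommSemiring R] (q : ℕ) (hc : 0 < c) (hn : 0 < n)
    {T₀ : (Fin n → Fin (2 * c + 1)) × (Fin n → Fin (2 * c + 1)) × (Fin n → Fin (2 * c + 1))} (hT₀ : T₀ ∈ D.𝒯α)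
    {p₀ : (Fin n → Fin (2 * c + 1)) × (Fin n → Fin c → Fin 3)} (hp₀ : p₀ ∈ D.typicalPairs)
    {Q : Fin (2 * c + 1) × Fin (2 * c + 1) × Fin (2 * c + 1) → ℕ} (h𝒯α : D.𝒯α = jointTypeClass n Q)
    (hQ : ∑ s, Q s = n) (hμX : D.μX = fun i => ∑ j, ∑ l, Q (i, j, l))
    (hμY : D.μY = fun j => ∑ i, ∑ l, Q (i, j, l)) (hμZ : D.μZ = fun l => ∑ i, ∑ j, Q (i, j, l))
    (kc : Fin (coarseClasses c).card → (Fin c → Fin 3) → ℕ)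
    (hk : ∀ s σ, (kc s σ : ℝ) = (termFibre (coarseTermMap (isLevelTriple_of_mem_tripleSet (hD.subset hT₀))) s).card *
      (coarseTermList c D.α D.γZ s).γX σ)
    (hsupp : ∀ s σ, kc s σ ≠ 0 → patternLevel σ = (coarseTermList c D.α D.γZ s).i)
    (hsum : ∀ s, ∑ σ, kc s σ = (termFibre (coarseTermMap (isLevelTriple_of_mem_tripleSet (hD.subset hT₀))) s).card) :
    ∃ (M : ℕ) (B : Finset (ZMod M)), M.Prime ∧ D.modulusBound p₀ < M ∧ M ≤ 2 * D.modulusBound p₀ ∧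
      ThreeAPFree (B : Set (ZMod M)) ∧ (M : ℝ) / 2 * Real.exp (-4 * Real.sqrt (Real.log M)) ≤ B.card ∧
      ∀ {r : ℕ}, 8 ^ (3 * Nat.log (2 * (c * n)) (3 ^ (c * n)) + 3) ≤ r →
        TensorRestrictsTo (kroneckerPow (kroneckerPow (bigCwTensor R q) c) n)
          (kroneckerTensor (unitTensor R (B.card * D.𝒯α.card / (2 * M ^ 2 * r))) (D.starTensor R q T₀)) ∧
        (n : ℝ) * min (min (shannonEntropy (fun i => (D.μX i : ℝ) / n) -
              (maxEntropyGivenMarginals (levelSupport (2 * c)) (fun s => (Q s : ℝ) / n) - shannonEntropy (fun s => (Q s : ℝ) / n)))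
            (shannonEntropy (fun j => (D.μY j : ℝ) / n) -
              (maxEntropyGivenMarginals (levelSupport (2 * c)) (fun s => (Q s : ℝ) / n) - shannonEntropy (fun s => (Q s : ℝ) / n))))
          (min (shannonEntropy (fun a => (letterCount (pairSeq p₀.1 p₀.2) a : ℝ) / n) -
              (∑ s, ((termFibre (coarseTermMap (isLevelTriple_of_mem_tripleSet (hD.subset hT₀))) s).card : ℝ) *
                shannonEntropy (fun σ => (kc s σ : ℝ) /
                  (termFibre (coarseTermMap (isLevelTriple_of_mem_tripleSet (hD.subset hT₀))) s).card)) / n)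
            (shannonEntropy (fun s => (Q s : ℝ) / n))) -
          ((2 * Fintype.card (Fin (2 * c + 1) × Fin (2 * c + 1) × Fin (2 * c + 1)) + (2 * c + 1) +
              Fintype.card (Fin (2 * c + 1) × (Fin c → Fin 3))) * Real.logb 2 ((n : ℝ) + 1) +
            Real.logb 2 (160 * (c * n)) + Real.logb 2 (2 * c + 2) + Real.logb 2 r +
            4 * Real.sqrt (Real.log (2 * D.modulusBound p₀)) / Real.log 2 + 7) ≤
        Real.logb 2 ((B.card * D.𝒯α.card / (2 * M ^ 2 * r) : ℕ) + 1 : ℝ) := by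
  obtain ⟨M, B, hMp, hM₀M, hM2, hBfree, hBcard, hres⟩ :=
    vxxz2024_prop51_region_parameters D hD hS R q hc hn hT₀ hp₀
  refine ⟨M, B, hMp, hM₀M, hM2, hBfree, hBcard, fun {r} hr => ⟨hres hr, ?_⟩⟩
  -- positivity facts
  have hT₀𝒯 : T₀ ∈ D.tripleSet := hD.subset hT₀
  have hApos : 0 < D.𝒯α.card := card_pos.2 ⟨T₀, hT₀⟩
  have hTtpos : 0 < D.tripleSet.card := card_pos.2 ⟨T₀, hT₀𝒯⟩
  have hXpos : 0 < (typeClass n D.μX).card := card_pos.2 ⟨T₀.1, mem_typeClass.2 (mem_typedSupport.1 hT₀𝒯).1⟩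
  have hYpos : 0 < (typeClass n D.μY).card := card_pos.2 ⟨T₀.2.1, mem_typeClass.2 (mem_typedSupport.1 hT₀𝒯).2.1⟩
  have hM₀pos : 0 < D.modulusBound p₀ := by
    have : 2 * c + 2 ≤ D.modulusBound p₀ := le_max_of_le_right (le_max_right _ _)
    omega
  have hrpos : 0 < r := lt_of_lt_of_le (pow_pos (by norm_num) _) hr
  have hℓ0 : 0 ≤ Real.logb 2 ((n : ℝ) + 1) :=
    Real.logb_nonneg one_lt_two (by have := Nat.cast_nonneg (α := ℝ) n; linarith)
  have hnr : (0 : ℝ) < n := by exact_mod_cast hn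
  have hM₀r : (0 : ℝ) < D.modulusBound p₀ := by exact_mod_cast hM₀pos
  have hcn : (0 : ℝ) < 160 * ((c : ℝ) * n) := by
    have : (0:ℝ) < c := by exact_mod_cast hc
    positivity
  have hlog160 : 0 ≤ Real.logb 2 (160 * ((c : ℝ) * n)) := by
    refine Real.logb_nonneg one_lt_two ?_
    have : (1:ℝ) ≤ c := by exact_mod_cast hc
    have : (1:ℝ) ≤ n := by exact_mod_cast hn
    nlinarith
  have hlog2c : 0 ≤ Real.logb 2 (2 * (c : ℝ) + 2) :=
    Real.logb_nonneg one_lt_two (by have := Nat.cast_nonneg (α := ℝ) c; linarith)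
  -- the sums of the marginal types (types of the blocks of `T₀`)
  have hμXsum : ∑ i, D.μX i = n := by
    rw [← (mem_typedSupport.1 hT₀𝒯).1]; exact sum_letterCount _
  have hμYsum : ∑ j, D.μY j = n := by
    rw [← (mem_typedSupport.1 hT₀𝒯).2.1]; exact sum_letterCount _
  have hFin : (Fintype.card (Fin (2 * c + 1)) : ℝ) = 2 * c + 1 := by simp
  -- the pieces
  have eA := logb_card_alphaTriples_ge (D := D) h𝒯α hQ
  have eT := logb_card_tripleSet_le (D := D) hn hμX hμY hμZ
  have eX := logb_card_typeClass_ge D.μX hμXsum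
  have eY := logb_card_typeClass_ge D.μY hμYsum
  rw [hFin] at eX eY
  have e0 := logb_copies_ge (A := D.𝒯α.card) (Bc := B.card) hM₀pos hM₀M hM2 hrpos hBcard hApos
  -- the four branches of `M₀`
  have hM₀le := modulusBound_le (D := D) p₀ hXpos hYpos
  have h16 : Real.logb 2 (16 : ℝ) = 4 := by
    rw [show (16:ℝ) = 2 ^ (4:ℕ) by norm_num, Real.logb_pow, Real.logb_self_eq_one one_lt_two]; norm_num
  have hbranch : Real.logb 2 (D.modulusBound p₀) ≤ 4 + Real.logb 2 (D.tripleSet.card) - Real.logb 2 ((typeClass n D.μX).card) ∨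
      Real.logb 2 (D.modulusBound p₀) ≤ 4 + Real.logb 2 (D.tripleSet.card) - Real.logb 2 ((typeClass n D.μY).card) ∨
      (Real.logb 2 (D.modulusBound p₀) ≤ Real.logb 2 (160 * ((c : ℝ) * n)) + Real.logb 2 ((D.compatTriples p₀.1 p₀.2).card) ∧
        Real.logb 2 ((D.compatTriples p₀.1 p₀.2).card) ≤ Real.logb 2 (D.𝒯α.card) +
          (∑ s, ((termFibre (coarseTermMap (isLevelTriple_of_mem_tripleSet (hD.subset hT₀))) s).card : ℝ) *
            shannonEntropy (fun σ => (kc s σ : ℝ) /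
              (termFibre (coarseTermMap (isLevelTriple_of_mem_tripleSet (hD.subset hT₀))) s).card)) -
          (n : ℝ) * shannonEntropy (fun a => (letterCount (pairSeq p₀.1 p₀.2) a : ℝ) / n) +
          Fintype.card (Fin (2 * c + 1) × (Fin c → Fin 3)) * Real.logb 2 ((n : ℝ) + 1)) ∨
      Real.logb 2 (D.modulusBound p₀) ≤ Real.logb 2 (2 * (c : ℝ) + 2) := by
    rcases le_max_iff.1 hM₀le with h12 | h34
    · rcases le_max_iff.1 h12 with h1 | h2
      · left
        have hl := Real.logb_le_logb_of_le one_lt_two hM₀r h1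
        rw [Real.logb_div (by positivity) (by exact_mod_cast hXpos.ne'),
          Real.logb_mul (by norm_num) (by exact_mod_cast hTtpos.ne'), h16] at hl
        exact hl
      · right; left
        have hl := Real.logb_le_logb_of_le one_lt_two hM₀r h2
        rw [Real.logb_div (by positivity) (by exact_mod_cast hYpos.ne'),
          Real.logb_mul (by norm_num) (by exact_mod_cast hTtpos.ne'), h16] at hl
        exact hl
    · rcases le_max_iff.1 h34 with h3 | h4
      · right; right; left
        have hVpos : 0 < (D.compatTriples p₀.1 p₀.2).card := by
          by_contra hV0
          rw [not_lt, Nat.le_zero] at hV0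
          rw [hV0] at h3; simp at h3; linarith
        have hl := Real.logb_le_logb_of_le one_lt_two hM₀r h3
        rw [Real.logb_mul hcn.ne' (by exact_mod_cast hVpos.ne')] at hl
        exact ⟨hl, logb_card_compatTriples_le hD hS hT₀ hp₀ kc hk hsupp hsum hVpos⟩
      · right; right; right
        exact Real.logb_le_logb_of_le one_lt_two hM₀r h4
  have key := exponent_combine (lM₀ := Real.logb 2 (D.modulusBound p₀)) hnr hℓ0 (Nat.cast_nonneg _) (Nat.cast_nonneg _)
    (by positivity : (0:ℝ) ≤ 2 * (c : ℝ) + 1) hlog160 hlog2c eA eT eX eY hbranch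
  linarith [key, e0]

end GlobalStageData

end Literature.Computability.AlgebraicComplexity
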